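import Summits.ABC.StewartYu.PadicG3TwoLevelZeroAll
import Summits.ABC.StewartYu.PadicG3TwoEndTwo
import Summits.ABC.StewartYu.PadicG3TwoRecordL1S
import HarnessLib

/-!
# Cell abc-stewartyu, Gen-3 frame at `p = 2` (crux `Y07Two`, stmt-ABC-19659), record interface: the PER-DATUM PACKAGE
# of `stub_frameTwoLast_of_numericsRA` assembled from the schedule of record, (L1), the END block and a record

`Summits/ABC/StewartYu/PadicG3TwoDatumPackage.lean` — cell `abc-stewartyu` (HOME `run/shared/lean/pub/abc-stewartyu/`),
route `PadicPrimesKummerThird`, seat p5 (g3).  One theorem (glue; interface rehearsal for the closer of p3-g6):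
**`datum_package_two`** — for a set-up `S`, a parameter record `P : PadicG3Par (S.d+1)` with `P.Nq = 2^{P.m+2}`, the
budget lines (L2₀) (level `0`, all nodes), (L2) (`1 ≤ I ≤ I*`), (L3ᴿ) on the projections of `schedTwoS S P`, the slab
smallness `‖Λ₀‖ ≤ 2^{−(m+3)}` and a record `RecordTwo C (d+1) V Vmax W P.D₀ P.S₀N P.Xfin P.D`, the existential
package `∃ σ H L₀ S₀ X D₀′ D′, FrameNumericsTwoRA σ H L₀ ∧ … ∧ RecordTwo …` demanded per datum by
`TwoSetup.stub_frameTwoLast_of_numericsRA` — witnessed by `σ := schedTwoS S P`, `H := P.H`, `L₀ := P.L₀`,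
`S₀ := P.S₀N`, `X := P.Xfin`, `D₀′ := P.D₀`, `D′ := P.D` (hdepth by `hdepth_two`, (L1) by `hL1_schedTwoS`, END by
`end_range_two`/`end_order_two`/`D₀_schedTwoS_le`/`end_box_two`).  At `S := ofData d α b hα hb hmin` this is
literally the body of the closer's `fun hZ d hd α b V Vmax W … hneg => …`.

WHAT THIS IS NOT: the budget lines, the smallness, the record, the closer (p3-g6); no crux moves.

References: K. Yu, Acta Math. 211 (2013), §6; Yu. V. Nesterenko, LNM 1819 (2003), §5.2.
-/

noncomputable section

open Finset
open Literature.NumberTheory.Transcendental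
open Literature.NumberTheory.Transcendental.CW77 (heightProd)
open Literature.NumberTheory.Transcendental.CW77.Setup (Tau tauNorm)
open Literature.NumberTheory.Transcendental.PadicCW77 (condExp)

namespace Summit.ABC.StewartYu

namespace TwoSetup

variable (S : TwoSetup) (P : PadicG3Par (S.d + 1))

/-- **THE PER-DATUM PACKAGE of `stub_frameTwoLast_of_numericsRA` from the schedule of record, the budget lines,
the slab smallness and a record at `(P.D₀, P.S₀N, P.Xfin, P.D)`.** [cite: Yu2013, §6; shape only] -/
theorem datum_package_two (hNq : P.Nq = 2 ^ (P.m + 2))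
    (hL2₀ : ∀ k, k < (S.schedTwoS P).kst 0 → ∀ x₁ : ℤ, |x₁| ≤ ((S.schedTwoS P).Nsub 0 (k + 1) : ℤ) →
      ∀ τ : Tau S.d, tauNorm τ + (S.schedTwoS P).tdec 0 ≤ (S.schedTwoS P).T0 0 - k * (S.schedTwoS P).tdec 0 →
      max ((S.schedTwoS P).Bw 0 * ‖S.Λ₀‖ * (2 : ℝ) ^ (S.schedTwoS P).tdec 0 *
            (2 : ℝ) ^ condExp 2 (2 * (S.schedTwoS P).Nsub 0 k + 1) ((S.schedTwoS P).tdec 0))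
          ((S.schedTwoS P).Bw 0 / (4 * (2 : ℝ) ^ (S.schedTwoS P).m) ^ gainExpA (S.schedTwoS P) 0 k) <
        1 / KTwo (S.schedTwoS P) 0 x₁ τ)
    (hL2 : ∀ I, 1 ≤ I → I ≤ S.Istar3 P → ∀ k, k < (S.schedTwoS P).kst I → ∀ x₁ : ℤ,
      |x₁| ≤ ((S.schedTwoS P).Nsub I (k + 1) : ℤ) →
      ∀ τ : Tau S.d, tauNorm τ + (S.schedTwoS P).tdec I ≤ (S.schedTwoS P).T0 I - k * (S.schedTwoS P).tdec I →
      max ((S.schedTwoS P).Bw I * ‖S.Λ₀‖ * (2 : ℝ) ^ (S.schedTwoS P).tdec I *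
            (2 : ℝ) ^ condExp 2 (2 * (S.schedTwoS P).Nsub I k + 1) ((S.schedTwoS P).tdec I))
          ((S.schedTwoS P).Bw I / (4 * (2 : ℝ) ^ (S.schedTwoS P).m) ^ gainExp (S.schedTwoS P) I k) <
        1 / KTwo (S.schedTwoS P) I x₁ τ)
    (hL3 : ∀ I, I < S.Istar3 P → ∀ s : ℤ, |s| ≤ ((S.schedTwoS P).N0 (I + 1) : ℤ) → ¬ (3 : ℤ) ∣ s →
      ∀ τ : Tau S.d, tauNorm τ < (S.schedTwoS P).T0 (I + 1) →
      max ((S.schedTwoS P).Bw I * ‖S.Λ₀‖ * (2 : ℝ) ^ ((S.schedTwoS P).Tfin I - (S.schedTwoS P).T0 (I + 1)) *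
            (2 : ℝ) ^ condExp 2 (2 * (S.schedTwoS P).Nfin I + 1)
              ((S.schedTwoS P).Tfin I - (S.schedTwoS P).T0 (I + 1)))
          ((S.schedTwoS P).Bw I / (4 * (2 : ℝ) ^ (S.schedTwoS P).m) ^
            ((2 * (S.schedTwoS P).Nfin I + 1) * ((S.schedTwoS P).Tfin I - (S.schedTwoS P).T0 (I + 1)))) <
        1 / (6 * (thirdDen (S.schedTwoS P) I s τ : ℝ) * thirdM (S.schedTwoS P) I s τ *
          heightProd S.toQ.all ^ 5) ^ (3 ^ (S.d + 1 + 1) - 1))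
    (hΛ : ‖S.Λ₀‖ ≤ ((2 : ℝ) ^ (P.m + 3))⁻¹)
    {C : ℕ → ℝ} {V : Fin (S.d + 1) → ℝ} {Vmax W : ℝ}
    (hrec : GenThreeFrameSpecTwo.RecordTwo C (S.d + 1) V Vmax W P.D₀ P.S₀N P.Xfin P.D) :
    ∃ (σ : S.G3TwoSched) (H L₀ S₀ X D₀' : ℕ) (D' : Fin (S.d + 1) → ℕ),
      FrameNumericsTwoRA σ H L₀ ∧ ‖S.Λ₀‖ ≤ ((2 : ℝ) ^ (σ.m + 3))⁻¹ ∧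
      (S.d + 1 + 1) * X ≤ σ.Nfin σ.Istar ∧ (S.d + 1 + 1) * S₀ < σ.Tfin σ.Istar ∧
      σ.D₀ ≤ D₀' ∧ (∀ j, (Fin.snoc (σ.Dbox σ.Istar) (σ.Dθ σ.Istar) : Fin (S.d + 1) → ℕ) j ≤ D' j) ∧
      GenThreeFrameSpecTwo.RecordTwo C (S.d + 1) V Vmax W D₀' S₀ X D' :=
  ⟨S.schedTwoS P, P.H, P.L₀, P.S₀N, P.Xfin, P.D₀, P.D,
    S.frameNumericsTwoRA_schedTwoS P (S.hdepth_two P hNq) (S.hL1_schedTwoS P) hL2₀ hL2 hL3,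
    hΛ, S.end_range_two P hNq, S.end_order_two P, S.D₀_schedTwoS_le P, S.end_box_two P hNq, hrec⟩

end TwoSetup

end Summit.ABC.StewartYu

end
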